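import Mathlib
import Literature.AlgebraicGeometry.Resolution.WeightedQuasiRegularGeneral
import HarnessLib

/-!
# The weighted-order chart law for arbitrary positive weights

Topic: `Literature/AlgebraicGeometry/Resolution`. Generalisation of the contraction law of
`WeightedOrderChainLaw.lean` (weights `(1, d, d)`) to arbitrary positive integer weights — the
expansion-free form of the translation of Hironaka's characteristic polyhedron
`Δ(J; u₁, u₂; z)` under the blowing up of a closed point, as used in the proof of
Cossart–Piltant 2008, Lemma 4.5 (p. 12: "`Δ(E′; u₁, u₂/u₁; z/u₁)` […] the correspondence between
vertices […] `(α(x), β(x)) ↦ (α(x) + β(x) − 1, β(x))`"). Let `φ : R → R′` be a ring homomorphism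
between regular local rings of dimension `3`, `c = (c₀, c₁, c₂)` a regular system of parameters
of `R` and `c′` one of `R′` with `c′₁ = φ c₁`, `φ c₀ = φ c₁ · c′₀`, `φ c₂ = φ c₁ · c′₂` (the origin of
the `c₁`-chart; `c₁ = u₁`, `c₀ = z`, `c₂ = u₂`). For positive weights `W′` at `R′` put
`W = (W′₀ + W′₁, W′₁, W′₂ + W′₁)` (the pull-back of the weight under the monomial substitution).
PROVED:

* `weight_pullbackWeight`, `map_weightedIdealW_le` — `φ(F^{W}_ρ) ⊆ F′^{W′}_ρ`;
* `mem_weightedIdealW_of_map_mem` — **contraction** `F′^{W′}_ρ ∩ R = F^{W}_ρ` (weighted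
  quasi-regularity of `R′` for `W′`, `coeff_mem_maximalIdeal_of_weval_mem_general`);
* `le_weightedIdealW_of_weakTransform_le` — the law for weak transforms:
  `(JR′ : (φc₁)^μ) ⊆ F′^{W′}_{ρ′} ⇒ J ⊆ F^{W}_{ρ′ + μW′₁}` (vertex map `(α, β) ↦ (α + β − 1, β)`).

## Sources

* V. Cossart, O. Piltant, J. Algebra 320 (2008), proof of Lemma 4.5, p. 12. [CossartPiltant2008]
* H. Hironaka, *Characteristic polyhedra of singularities*, J. Math. Kyoto Univ. 7 (1967). [Hironaka1967]
-/

noncomputable section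

open IsLocalRing MvPolynomial

namespace Literature.AlgebraicGeometry.Resolution

universe u

section Chart

variable {R R' : Type u} [CommRing R] [CommRing R'] (φ : R →+* R') {c : Fin 3 → R}
  {c' : Fin 3 → R'} (h₁ : c' 1 = φ (c 1)) (h₀ : φ (c 0) = φ (c 1) * c' 0)
  (h₂ : φ (c 2) = φ (c 1) * c' 2) (W' : Fin 3 → ℕ)

/-- The pulled-back weight `W = (W′₀ + W′₁, W′₁, W′₂ + W′₁)`. [folklore] -/
def pullbackWeight (W' : Fin 3 → ℕ) : Fin 3 → ℕ := ![W' 0 + W' 1, W' 1, W' 2 + W' 1]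

/-- The exponent map of the chart: `(e₀, e₁, e₂) ↦ (e₀, e₀ + e₁ + e₂, e₂)`. [folklore] -/
def chartExpW (e : Fin 3 →₀ ℕ) : Fin 3 →₀ ℕ :=
  Finsupp.equivFunOnFinite.symm ![e 0, e 0 + e 1 + e 2, e 2]

/-- Components of `chartExpW`. [folklore] -/
@[simp] theorem chartExpW_apply_zero (e : Fin 3 →₀ ℕ) : chartExpW e 0 = e 0 := rfl
/-- Components of `chartExpW`. [folklore] -/
@[simp] theorem chartExpW_apply_one (e : Fin 3 →₀ ℕ) : chartExpW e 1 = e 0 + e 1 + e 2 := rfl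
/-- Components of `chartExpW`. [folklore] -/
@[simp] theorem chartExpW_apply_two (e : Fin 3 →₀ ℕ) : chartExpW e 2 = e 2 := rfl

/-- `chartExpW` is injective. [folklore] -/
theorem chartExpW_injective : Function.Injective chartExpW := by
  intro m m' h
  have h0 := congrArg (fun n : Fin 3 →₀ ℕ => n 0) h
  have h1 := congrArg (fun n : Fin 3 →₀ ℕ => n 1) h
  have h2 := congrArg (fun n : Fin 3 →₀ ℕ => n 2) h
  simp only [chartExpW_apply_zero, chartExpW_apply_one, chartExpW_apply_two] at h0 h1 h2
  ext i
  fin_cases i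
  · exact h0
  · simp only [Fin.mk_one]; omega
  · exact h2

/-- The chart turns the pulled-back weight into `W′`. [folklore] -/
theorem weight_chartExpW (W' : Fin 3 → ℕ) (e : Fin 3 →₀ ℕ) :
    Finsupp.weight W' (chartExpW e) = Finsupp.weight (pullbackWeight W') e := by
  rw [Finsupp.weight_apply, Finsupp.weight_apply, Finsupp.sum_fintype _ _ (by simp),
    Finsupp.sum_fintype _ _ (by simp)]
  simp only [Fin.sum_univ_three, chartExpW_apply_zero, chartExpW_apply_one, chartExpW_apply_two,
    pullbackWeight, Matrix.cons_val_zero, Matrix.cons_val_one, Matrix.cons_val_two,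
    Matrix.tail_cons, Matrix.head_cons, smul_eq_mul]
  ring

include h₁ h₀ h₂ in
/-- The image of a monomial: `φ(c^e) = c′^{chartExpW e}`. [folklore] -/
theorem map_monom3_chart (e : Fin 3 →₀ ℕ) : φ (monom3 c e) = monom3 c' (chartExpW e) := by
  simp only [monom3, map_mul, map_pow, h₀, h₂, ← h₁, chartExpW_apply_zero, chartExpW_apply_one,
    chartExpW_apply_two]
  ring

include h₁ h₀ h₂ in
/-- **`φ(F^{W}_ρ) ⊆ F′^{W′}_ρ`.** [cite: Hironaka1967, §1] -/
theorem map_weightedIdealW_le (ρ : ℕ) :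
    (weightedIdealW c (pullbackWeight W') ρ).map φ ≤ weightedIdealW c' W' ρ := by
  rw [weightedIdealW, Ideal.map_span]
  refine Ideal.span_le.mpr ?_
  rintro _ ⟨_, ⟨e, he, rfl⟩, rfl⟩
  rw [SetLike.mem_coe, map_monom3_chart φ h₁ h₀ h₂]
  refine monomial_mem_weightedIdealW c' W' ?_
  rwa [weight_chartExpW]

variable [IsRegularLocalRing R] [IsRegularLocalRing R']
  (hgen : Ideal.span (Set.range c) = maximalIdeal R)
  (hgen' : Ideal.span {c' 0, c' 1, c' 2} = maximalIdeal R') (hdim' : ringKrullDim R' = 3)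
  (hW' : ∀ i, 0 < W' i)

include h₁ h₀ h₂ hgen hgen' hdim' hW' in
/-- **Contraction** `F′^{W′}_ρ ∩ R ⊆ F^{W}_ρ` for the pulled-back weight `W`: an element of `R`
whose image lies in the weighted ideal of the chart lies in the weighted ideal of `R` (weighted
quasi-regularity of `R′` applied to the weight-`σ` part of a representative with a unit
coefficient). [cite: CossartPiltant2008, proof of Lemma 4.5, p. 12] [cite: Hironaka1967, §1] -/
theorem mem_weightedIdealW_of_map_mem {ρ : ℕ} {f : R}
    (hf : φ f ∈ weightedIdealW c' W' ρ) : f ∈ weightedIdealW c (pullbackWeight W') ρ := by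
  classical
  have hWpos : ∀ i, 0 < pullbackWeight W' i := by
    intro i
    fin_cases i
    · change 0 < W' 0 + W' 1; have := hW' 0; omega
    · exact hW' 1
    · change 0 < W' 2 + W' 1; have := hW' 2; omega
  suffices key : ∀ σ, σ ≤ ρ → f ∈ weightedIdealW c (pullbackWeight W') σ from key ρ le_rfl
  intro σ
  induction σ with
  | zero =>
    intro _
    have h1 : (1 : R) ∈ weightedIdealW c (pullbackWeight W') 0 := by
      have := monomial_mem_weightedIdealW c (pullbackWeight W') (ρ := 0) (e := 0) (by simp)
      simpa [monom3] using this
    simpa using Ideal.mul_mem_left _ f h1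
  | succ σ ih =>
    intro hσρ
    have hfσ := ih (by omega)
    obtain ⟨P, hP, hPf⟩ :=
      (mem_weightedIdealW_iff_exists_mvPolynomial c (pullbackWeight W') σ f).mp hfσ
    set Pσ := weightedHomogeneousComponent (pullbackWeight W') σ P with hPσ
    have hPσhom : Pσ.IsWeightedHomogeneous (pullbackWeight W') σ :=
      weightedHomogeneousComponent_isWeightedHomogeneous σ P
    have hrest : eval c (P - Pσ) ∈ weightedIdealW c (pullbackWeight W') (σ + 1) := by
      refine (mem_weightedIdealW_iff_exists_mvPolynomial c (pullbackWeight W') (σ + 1) _).mpr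
        ⟨P - Pσ, fun m hm => ?_, rfl⟩
      rw [mem_support_iff, coeff_sub, hPσ, coeff_weightedHomogeneousComponent] at hm
      by_cases hwt : Finsupp.weight (pullbackWeight W') m = σ
      · rw [if_pos hwt, sub_self] at hm; exact absurd rfl hm
      · rw [if_neg hwt, sub_zero] at hm
        have := hP m (mem_support_iff.mpr hm)
        omega
    set Q : MvPolynomial (Fin 3) R' :=
      ∑ n ∈ Pσ.support, monomial (chartExpW n) (φ (Pσ.coeff n)) with hQ
    have hQcoeff : ∀ n ∈ Pσ.support, Q.coeff (chartExpW n) = φ (Pσ.coeff n) := by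
      intro n hn
      rw [hQ, coeff_sum, Finset.sum_eq_single n]
      · rw [coeff_monomial, if_pos rfl]
      · intro n' _ hne
        rw [coeff_monomial, if_neg]
        exact fun h' => hne (chartExpW_injective h')
      · intro hn'; exact absurd hn hn'
    have hQsupp : ∀ m ∈ Q.support, Finsupp.weight W' m = σ := by
      intro m hm
      rw [hQ] at hm
      obtain ⟨n, hn, hmn⟩ := Finset.mem_biUnion.mp (support_sum hm)
      have hmn' := Finset.mem_singleton.mp (support_monomial_subset hmn)
      subst hmn'
      rw [weight_chartExpW]
      exact hPσhom (mem_support_iff.mp hn)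
    have hQeval : eval c' Q = φ (eval c Pσ) := by
      conv_rhs => rw [Pσ.as_sum, map_sum, map_sum]
      rw [hQ, map_sum]
      refine Finset.sum_congr rfl fun n _ => ?_
      rw [eval_monomial_eq_monom3, eval_monomial_eq_monom3, map_mul, map_monom3_chart φ h₁ h₀ h₂]
    have hQmem : eval c' Q ∈ weightedIdealW c' W' (σ + 1) := by
      rw [hQeval]
      have h1 : φ f ∈ weightedIdealW c' W' (σ + 1) := weightedIdealW_antitone _ _ hσρ hf
      have h2 : φ (eval c (P - Pσ)) ∈ weightedIdealW c' W' (σ + 1) :=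
        map_weightedIdealW_le φ h₁ h₀ h₂ W' (σ + 1) (Ideal.mem_map_of_mem _ hrest)
      have : eval c Pσ = f - eval c (P - Pσ) := by rw [map_sub, hPf]; ring
      rw [this, map_sub]
      exact Ideal.sub_mem _ h1 h2
    have hcoeff : ∀ n, Pσ.coeff n ∈ maximalIdeal R := by
      intro n
      by_cases hn : n ∈ Pσ.support
      swap
      · rw [notMem_support_iff.mp hn]; exact Ideal.zero_mem _
      have hc := coeff_mem_maximalIdeal_of_weval_mem_general c' hgen' hdim' W' hW' hQsupp hQmem
        (chartExpW n)
      rw [hQcoeff n hn] at hc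
      by_contra hcm
      have hunit : IsUnit (Pσ.coeff n) := by
        by_contra h'; exact hcm ((IsLocalRing.mem_maximalIdeal _).mpr h')
      exact (IsLocalRing.mem_maximalIdeal _).mp hc (hunit.map φ)
    have hPσmem : eval c Pσ ∈ weightedIdealW c (pullbackWeight W') (σ + 1) := by
      rw [Pσ.as_sum, map_sum]
      refine Ideal.sum_mem _ fun n hn => ?_
      rw [eval_monomial_eq_monom3, add_comm σ 1]
      have hmono : monom3 c n ∈ weightedIdealW c (pullbackWeight W') σ :=
        monomial_mem_weightedIdealW c _ (hPσhom (mem_support_iff.mp hn)).ge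
      have := maximalIdeal_mul_weightedIdealW_le c (pullbackWeight W') hWpos hgen σ
        (Ideal.mul_mem_mul (hcoeff n) hmono)
      rwa [add_comm] at this
    have : f = eval c Pσ + eval c (P - Pσ) := by rw [map_sub, hPf]; ring
    rw [this]
    exact Ideal.add_mem _ hPσmem hrest

include h₁ h₀ h₂ hgen hgen' hdim' hW' in
/-- **The weighted-order law under the blowing up, general weights**: if `J ⊆ 𝔪^μ` and the weak
transform `(JR′ : (φ c₁)^μ)` lies in `F′^{W′}_{ρ′}`, then `J ⊆ F^{W}_{ρ′ + μ W′₁}` for the pulled-back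
weight `W` (`(φ c₁)^μ` has `W′`-weight `μ W′₁`). [cite: CossartPiltant2008, proof of Lemma 4.5, p. 12]
[cite: Hironaka1967, §1] -/
theorem le_weightedIdealW_of_weakTransform_le {J : Ideal R} {μ ρ' : ℕ}
    (hJμ : J ≤ maximalIdeal R ^ μ)
    (hJ' : ∀ g : R', φ (c 1) ^ μ * g ∈ J.map φ → g ∈ weightedIdealW c' W' ρ') :
    J ≤ weightedIdealW c (pullbackWeight W') (ρ' + μ * W' 1) := by
  intro f hf
  refine mem_weightedIdealW_of_map_mem φ h₁ h₀ h₂ W' hgen hgen' hdim' hW' ?_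
  -- `φ(𝔪^μ) ⊆ ((φ c₁)^μ)`, so `φ f = (φ c₁)^μ g`
  have hφm : (maximalIdeal R).map φ ≤ Ideal.span {φ (c 1)} := by
    rw [← hgen, Ideal.map_span, Ideal.span_le]
    rintro _ ⟨_, ⟨i, rfl⟩, rfl⟩
    fin_cases i
    · change φ (c 0) ∈ _; rw [h₀]; exact Ideal.mul_mem_right _ _ (Ideal.subset_span rfl)
    · exact Ideal.subset_span rfl
    · change φ (c 2) ∈ _; rw [h₂]; exact Ideal.mul_mem_right _ _ (Ideal.subset_span rfl)
  have hφf : φ f ∈ Ideal.span {φ (c 1) ^ μ} := by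
    rw [← Ideal.span_singleton_pow]
    have : φ f ∈ (maximalIdeal R ^ μ).map φ := Ideal.mem_map_of_mem _ (hJμ hf)
    rw [Ideal.map_pow] at this
    exact Ideal.pow_right_mono hφm μ this
  obtain ⟨g, hg⟩ := Ideal.mem_span_singleton'.mp hφf
  rw [mul_comm] at hg
  have hg' : g ∈ weightedIdealW c' W' ρ' := hJ' g (hg ▸ Ideal.mem_map_of_mem _ hf)
  rw [← hg, add_comm ρ']
  refine weightedIdealW_mul_le c' W' (μ * W' 1) ρ' (Ideal.mul_mem_mul ?_ hg')
  have hmon : φ (c 1) ^ μ = monom3 c' (Finsupp.single 1 μ) := by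
    simp [monom3, h₁]
  rw [hmon]
  refine monomial_mem_weightedIdealW c' W' ?_
  rw [Finsupp.weight_apply, Finsupp.sum_single_index (by simp), smul_eq_mul]

end Chart

end Literature.AlgebraicGeometry.Resolution

end
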